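import Summits.CriticalPhenomena.PercolationContinuityZ3.Theorems.Transplant.SkelPhiFaceKitsG
import Summits.CriticalPhenomena.PercolationContinuityZ3.Theorems.Transplant.SkelPhiForcedFaceKitClause
import HarnessLib

/-!
# N2 (frames-only node), (S0) kit tier, (F) spine part K (hp-8 g39): **THE FORCED FACE KIT CLAUSES** — `FinePrm.hkits_face_of_routeF` (one
# face-frame level from a route at every near centre) and `hkits_faceStepWNbF` (one level `j′ ∈ [M+1, Rlev]` of the face step `faceStepWNb`) — the
# (S0) twins of hp-8 g33's `hkits_face_of_routeG` / `hkits_faceStepWNbG` (SkelPhiFaceKitsG; = `hkits_face_of_route` p291465 / `hkits_faceStepWNb`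
# p296538 with abstract pieces) over p1-g16's `kitClause_frameF` (SkelPhiForcedFaceKitClause, p339465): NO exit pieces, NO zone/exit estimates;
# the zone datum rows (`Λc c kz ⊆ Rg c`, connected from `c`, `c ∈ Λc c kz`) and the fat-prism rows (`1 ≤ kz`, `cylRadMax types kz (2·KCmax) ≤ Rk`,
# `cylBallFin c kz Rk ⊆ Λc c kz` — discharging `kitClause_frameF`'s column row `hcol` by `ctColEnd_mem_cylBallFin`) come in; the route is asked at
# accuracy `δ³` (`1 − δ³ ≤ P_{Wt}(linkIn Qt (Λc c kz) Ft)`); conclusion = the per-level clause of `TStep.KitsAtF`.  The kit-free helpers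
# `winLevel_subset_stepRg_faceStepWNb` / `far_mem_faceStepWNb_T` (SkelPhiFaceKitsRunNb) are N1's, imported.

builds on p205010 (kernel theorem, internal audit signed; external expert review pending) — nothing in this file uses p205010; nothing here is a
claim about the open node `SamePDropOfSkeletonFrm₁`.
Lane `prim-bschramm`, seat `prim-hp-8` (gen 39); helper file (`--supports stmt-CriticalPhenomena-4575 --as helper`); F-PORT-JUNCTIONS (hp-8 g37).
* **`FinePrm.hkits_face_of_routeF`**, **`hkits_faceStepWNbF`**.
[cite: KozmaNitzan2024, §4 Lemma 10 (pp. 17–21), Lemma 12 (pp. 23–25), p. 30 (Step III)] [cite: MartineauTassion2017, §4.3 Lemma 4.2]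
-/

noncomputable section

open scoped Classical

namespace Summit.CriticalPhenomena.PercolationContinuityZ3.Theorems.Transplant

namespace Skelφ

open MeasureTheory
open Literature.Probability.Percolation Literature.Probability.LatticeModels SimpleGraph KNLevels GadgetSystem Contour
open Literature.Barriers.CriticalPhenomena (graphBall graphBall_finite mem_graphBall_self graphBall_mono)
open Skel (winGraph winGraph_adj winGraph_le KitGeom WinStepData)
open SkelI (tanOff tanTgt tanTgt_mem)
open Literature.Probability.Percolation.KozmaNitzan.Cells (oth oth_ne eq_oth_of_ne oth_oth)
open BoxProdZ2 (ConcRadiiG)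

variable {V : Type} [DecidableEq V] {G : SimpleGraph V} [G.LocallyFinite] {φ : V → Site 2}

namespace FinePrm

/-- **THE FORCED KIT CLAUSE OF A FACE-FRAME LEVEL FROM A ROUTE AT EVERY NEAR CENTRE** (`hkits` of `kitsAt_stepAFF` / of `faceOblRM_fineNb`'s
F-twin at one level `j` of the face step; the (S0) twin of `hkits_face_of_routeG`/`hkits_face_of_route`): the window is hp-8's face frame
`pr.frame φ t I b` about `w₀` (radius `R`), the level box `[lo − j, hi + j]`, the region `D ⊇` the level window, the target `T` holds the far part of
the level; the zone datum `Λc c kz` at the kit centres (inside `Rg c`, connected, `c ∈ Λc c kz`, containing the fat-prism box `cylBallFin c kz Rk`);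
and at every centre in the `E`-enlarged box within `B(w₀, R − r)` a ROUTE `∃ Qt Ft, Ft ⊆ T ∧ Qt ⊆ D ∧ 1 − δ³ ≤ P_{Wt}(linkIn Qt (Λc c kz) Ft)`.
No zone estimate, no exit pieces ((S0): the kit's own seed box is forced — p1-g16's `kitClause_frameF`).
[cite: KozmaNitzan2024, §4 Lemma 10 (pp. 17–21)] [cite: MartineauTassion2017, §4.3 Lemma 4.2] [this work] -/
theorem hkits_face_of_routeF [Countable V] {types : Finset V} (hlipφ : Lip G φ) (hstep : Steps G φ) (hfr : Frames G φ types)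
    (hκ : CylConn G φ types) {Δ : ℕ} (hΔ : ∀ v, G.degree v ≤ Δ) {q : unitInterval} {δ : ℝ} (hδ : 0 < δ)
    -- the face frame
    (pr : FinePrm) (t : V) (I b : Fin 2) (hD : 0 < pr.D) (hL0 : pr.c₀ * pr.L 0 ≤ pr.D)
    (hL1 : pr.c₁ * pr.L 1 ≤ pr.D) (hc : 0 < pr.cOf I) (hA0 : 0 < pr.A) (hb : |pr.lvGen I (oth b)| ≤ |pr.lvGen I b|)
    (hnz : pr.lvGen I b ≠ 0) {nF : ℕ} (hnC : (nF : ℤ) ≤ pr.cOf I * |pr.A| * |pr.lvGen I b|) (hU3 : pr.D ≤ 3 * (nF : ℤ))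
    -- the level box and the window
    {lo hi : Site 2} {j : ℕ} {w₀ : V} {R r : ℕ}
    -- kit constants
    (P : ApronPrm) {nz Rs KCmax rs cS cU E : ℕ} (hPN : 3 ≤ P.N) (hA : P.A = (nz + 1 : ℕ) * pr.D + 1)
    (hdD : P.d + 2 ≤ shellD P) (hDρ : Rs + 1 ≤ shellD P) (hKCmax : (shellD P + nz + 1) * 3 ≤ KCmax)
    (hwide : ∀ i, (lo - (j : Site 2)) i + 2 * tanOff P.ℓs P.M ≤ (hi + (j : Site 2)) i)
    (hdw : ∀ i, (lo - (j : Site 2)) i + (P.d + 2 : ℕ) ≤ (hi + (j : Site 2)) i)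
    (hDw : ∀ i, (lo - (j : Site 2)) i + ((shellD P + 1 + P.d + KCmax + Rs : ℕ) : ℤ) ≤ (hi + (j : Site 2)) i)
    (hT' : (shellD P : ℤ) + KCmax + Rs ≤ tanOff P.ℓs P.M)
    (hr₀ : P.N * (tanOff P.ℓs P.M + 2) + P.N * P.d + (KCmax + Rs) ≤ P.r₀) (hR : P.r₀ ≤ R)
    (hrs : 1 + (P.N * (tanOff P.ℓs P.M + 2) + P.N * P.d + (KCmax + Rs)) ≤ rs)
    (hcS : (P.N + 1) * (tanOff P.ℓs P.M + 1) + (P.N + 1) * P.d + (KCmax + 1) + cU ≤ cS)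
    -- the reach of the kit centre: inside the `E`-enlargement, and `B(w₀, R − r)`
    (hE : j + (P.N * (tanOff P.ℓs P.M + 1) + P.N * P.d + KCmax) ≤ E) (hreach : r + (P.N * (tanOff P.ℓs P.M + 1) + P.N * P.d + KCmax) ≤ P.r₀)
    -- the short region and the zone datum at the kit centres (inside `Rg`, connected from the centre inside itself, containing the centre and the
    -- fat-prism zone box of record `cylBallFin c kz Rk`, `Rk ≥ cylRadMax types kz (2·KCmax)`)
    (Rg : V → Finset V) (hRg : ∀ c, ∀ u ∈ Rg c, u ∈ graphBall G c Rs) (hRgcard : ∀ c, (Rg c).card ≤ cU) (hcU1 : 1 ≤ cU)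
    (Λc : V → ℕ → Finset V) (kz : ℕ) (hΛRg : ∀ c, Λc c kz ⊆ Rg c) (hzconn : ∀ c, ∀ s ∈ Λc c kz, PathIn G (↑(Λc c kz) : Set V) c s)
    (hcz : ∀ c, c ∈ Λc c kz) {Rk : ℕ} (hkz : 1 ≤ kz) (hRk : cylRadMax G φ types kz (2 * KCmax) ≤ Rk)
    (hΛcyl : ∀ c, cylBallFin G φ c kz Rk ⊆ Λc c kz)
    -- the level's source/support, the weighting on the region, the target
    (kk : ℕ) (o : V) (Sfin : Finset V) {Wt : Sym2 V → unitInterval} {D T : Finset V}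
    (hXD : winLevel G (pr.frame φ t I b) w₀ R lo hi j ⊆ D)
    (hfarT : ∀ v ∈ winLevel G (pr.frame φ t I b) w₀ R lo hi j, v ∉ graphBall G w₀ (R - P.r₀) → v ∈ T)
    {N : ℕ} (hN : kk * (Δ + 1) ^ (2 * rs) ≤ N) (hk : (1 - (q : ℝ) ^ (1 + Δ * cS + cS * cU)) ^ kk ≤ δ)
    -- THE ROUTE at every centre of the enlarged box near the window centre, at accuracy `δ³` (no zone / exit estimates: (S0))
    (hroute : ∀ c, pr.frame φ t I b c ∈ Finset.Icc (lo - ((E : ℕ) : Site 2)) (hi + ((E : ℕ) : Site 2)) → c ∈ graphBall G w₀ (R - r) →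
      ∃ Qt Ft : Finset V, Ft ⊆ T ∧ Qt ⊆ D ∧ 1 - δ ^ 3 ≤ (prodBernoulli Wt).real (linkIn (↑Qt : Set V) (Λc c kz) Ft)) :
    ∃ (σ' : SData V) (S : Finset V), SHyp (winLData G (pr.frame φ t I b) w₀ R lo hi o Sfin) j σ' ∧ σ'.N ≤ N ∧
      (1 - (q : ℝ) ^ σ'.sB) ^ σ'.k ≤ δ ∧ S ⊆ D ∧ (∀ x ∈ σ'.K, σ'.face x ⊆ S) ∧
      RelayClause (winLData G (pr.frame φ t I b) w₀ R lo hi o Sfin) Wt j σ' S T D δ := by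
  set ψ := pr.frame φ t I b with hψ
  set SF := pr.sideFormsU_frame φ t I b hc hA0.ne' hnz hD (lo - (j : Site 2)) (hi + (j : Site 2)) with hSF
  have hKeq : winLevel G ψ w₀ R lo hi j = Win G ψ w₀ (Finset.Icc (lo - (j : Site 2)) (hi + (j : Site 2))) R := rfl
  have hLI : pr.cOf I * pr.L I ≤ pr.D := pr.cOf_mul_L_le hL0 hL1 I
  -- the frame facts used for the reach
  have hlip : Lip G ψ := pr.lip_frame hlipφ t I b hc.le hD hLI
  have hU3' : pr.D ≤ 3 * (pr.cOf I * |pr.A| * |pr.lvGen I b|) := hU3.trans (by linarith only [hnC])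
  have hq : QStepsN G ψ P.N := (qStepsN_of_qSteps (pr.qSteps_frame hstep t I b hc hA0.ne' hD hLI hb hnz hU3')).mono hPN
  have hU1 : (1 : ℤ) ≤ pr.D := hD
  have hnF1 : 1 ≤ nF := by
    have h3 : (0 : ℤ) < 3 * (nF : ℤ) := lt_of_lt_of_le hD hU3
    omega
  have hnD : (nF : ℤ) ≤ pr.D := hnC.trans ((pr.cOf_abs_lvGen_le I b hc.le).trans hLI)
  have hU : pr.D ≤ ((2 + 1 : ℕ) : ℤ) * nF := by
    have e' : ((2 + 1 : ℕ) : ℤ) * nF = 3 * (nF : ℤ) := by push_cast; ring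
    rw [e']; exact hU3
  have haff : ∀ (i : Fin 2) (σ₀ : ℤˣ), (SF i σ₀).IsAffine pr.D (pr.climC I b i) := fun i σ₀ => by
    rw [hSF]; exact pr.sideFormsU_frame_isAffine φ t I b hc hA0.ne' hnz hD hLI _ _ i σ₀
  have hC : ∀ (i : Fin 2) (σ₀ : ℤˣ), (nF : ℤ) ≤ pr.climC I b i := fun i σ₀ => by
    unfold FinePrm.climC; split_ifs
    · exact hnC
    · exact hnD
  have hKCmax' : (shellD P + nz + 1) * (2 + 1) ≤ KCmax := hKCmax
  have hKC := hKC_of_affine SF haff hU1 P hnF1 hC hU hA hKCmax'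
  -- the column row for the fat-prism zone box (p1-g16's `ctColEnd_mem_cylBallFin`)
  have hw2 : ∀ i, (lo - (j : Site 2)) i + 2 ≤ (hi + (j : Site 2)) i := fun i => by
    have h := hdw i; push_cast at h; linarith [Nat.cast_nonneg (α := ℤ) P.d]
  have hcol := fun x (hx : x ∈ outerBoundary (winGraph G w₀ R) (Win G ψ w₀ (Finset.Icc (lo - (j : Site 2)) (hi + (j : Site 2))) R))
      (_ : IsNear G ψ (lo - (j : Site 2)) (hi + (j : Site 2)) P w₀ R x) =>
    hΛcyl _ (ctColEnd_mem_cylBallFin SF hlip hq hstep hfr hκ hw2 (fun i σ₀ z h1 _ => hKC i σ₀ z h1) hkz hRk hx)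
  refine kitClause_frameF hlipφ hstep hΔ hδ pr t I b hD hL0 hL1 hc hA0.ne' hb hnz hnC hU3 P hPN hA hdD hDρ hKCmax hwide hdw hDw hT' hr₀ hR hrs
    hcS Rg hRg hRgcard hcU1 Λc kz hΛRg hzconn hcz hcol kk o Sfin hXD hN hk (fun x hx hfar => ?_) (fun x hx hnear => ?_)
  · -- FAR: the inner neighbour lies in the level and outside `B(w₀, R − r₀)`
    refine hfarT _ ?_ hfar
    have h := inNbr_spec (G := G) (φ := ψ) (by rw [hKeq] at hx; exact hx)
    rw [hKeq]
    exact (mem_Win G ψ).2 ⟨h.2.1, h.2.2⟩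
  · -- NEAR: the route at the kit centre (the zone-box disjunction's second branch)
    refine Or.inr ?_
    have hx' : x ∈ outerBoundary (winGraph G w₀ R) (Win G ψ w₀ (Finset.Icc (lo - (j : Site 2)) (hi + (j : Site 2))) R) := by
      rw [hKeq] at hx; exact hx
    set c := ctCtr G SF P w₀ R x with hcdef
    have hcI : ψ c ∈ Finset.Icc (lo - ((E : ℕ) : Site 2)) (hi + ((E : ℕ) : Site 2)) :=
      ψ_ctCtr_mem_Icc SF hlip hq hstep hwide (fun i σ₀ z h1 _ => hKC i σ₀ z h1) hE hx
    have hcw : c ∈ graphBall G w₀ (R - r) := by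
      have hd := ctCtr_reach SF hlip hq hstep hwide (fun i σ₀ z h1 _ => hKC i σ₀ z h1) hx'
      have h := BoxProdZ2.mem_graphBall_add G hnear hd
      exact graphBall_mono G _ (by omega) h
    exact hroute c hcI hcw

end FinePrm

/-- **THE FORCED KIT CLAUSE OF LEVEL `j′ ∈ [M+1, Rlev]` OF THE FACE STEP `faceStepWNb`** (the `hkits` hypothesis of `faceOblRM_fineNb`'s
F-twin at one level; the (S0) twin of `hkits_faceStepWNbG`), from the zone datum rows and a route at accuracy `δ³` at every centre of the
`E`-enlarged level box inside `B(w₀, rE − r)`. [cite: KozmaNitzan2024, §4 Lemma 10 (pp. 17–21), p. 30 (Step III)] [cite: MartineauTassion2017, §4.3 Lemma 4.2] -/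
theorem hkits_faceStepWNbF [Countable V] {types : Finset V} (hlipφ : Lip G φ) (hstep : Steps G φ) (hfr : Frames G φ types)
    (hκ : CylConn G φ types) {Δ : ℕ} (hΔ : ∀ v, G.degree v ≤ Δ) {q : unitInterval} {δ : ℝ} (hδ : 0 < δ)
    -- the face frame at the window centre
    (pr : FinePrm) (w₀ : V) (du : MDir) (b : Fin 2) (hc₀ : 0 < pr.c₀) (hc₁ : 0 < pr.c₁) (hD : 0 < pr.D) (hL0 : pr.c₀ * pr.L 0 ≤ pr.D)
    (hL1 : pr.c₁ * pr.L 1 ≤ pr.D) (hA0 : 0 < pr.A) (hb : |pr.lvGen du.1 (oth b)| ≤ |pr.lvGen du.1 b|)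
    (hnz : pr.lvGen du.1 b ≠ 0) {nF : ℕ} (hnC : (nF : ℤ) ≤ pr.cOf du.1 * |pr.A| * |pr.lvGen du.1 b|) (hU3 : pr.D ≤ 3 * (nF : ℤ))
    -- the face step
    (P : PCells2) (Λ : ConcRadiiG) (b₀ : Fin 2 → ℕ) (a' : ℕ) (x : Site 2) (j : ℕ) (pc : ℤ) (aw Rlev N M L' : ℕ) (Sfin : Finset V)
    {yF : V} (hyF : pr.ψ φ w₀ yF = P.faceCen x du j) (hpc : pc = relφ φ w₀ yF b) (hjK : j + 1 ≤ P.K) (hRlev : Rlev + 4 ≤ 10 * P.s du.1)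
    (hRlev' : Rlev + 4 ≤ 3 * P.r (oth du.1)) {kF : ℤ}
    (hroomF : pr.Mabs * (aw + Rlev + 1) + pr.rdN du.1 b * (Rlev + 2) * pr.D ≤ pr.rdK du.1 b * kF * pr.D) (hkF : kF + 3 ≤ 5 * P.r (oth du.1))
    {j' : ℕ} (hj'M : M + 1 ≤ j') (hj'R : j' ≤ Rlev)
    -- kit constants
    (PA : ApronPrm) {nz Rs KCmax rs cS cU E r : ℕ} (hPN : 3 ≤ PA.N) (hA : PA.A = (nz + 1 : ℕ) * pr.D + 1)
    (hdD : PA.d + 2 ≤ shellD PA) (hDρ : Rs + 1 ≤ shellD PA) (hKCmax : (shellD PA + nz + 1) * 3 ≤ KCmax)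
    (hMtan : tanOff PA.ℓs PA.M ≤ (M : ℤ) + 1) (hMd : PA.d + 2 ≤ 2 * M + 2) (hMD : shellD PA + 1 + PA.d + KCmax + Rs ≤ 2 * M + 2)
    (hT' : (shellD PA : ℤ) + KCmax + Rs ≤ tanOff PA.ℓs PA.M)
    (hr₀ : PA.N * (tanOff PA.ℓs PA.M + 2) + PA.N * PA.d + (KCmax + Rs) ≤ PA.r₀) (hR : PA.r₀ ≤ Λ.rE a' x du)
    (hrs : 1 + (PA.N * (tanOff PA.ℓs PA.M + 2) + PA.N * PA.d + (KCmax + Rs)) ≤ rs)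
    (hcS : (PA.N + 1) * (tanOff PA.ℓs PA.M + 1) + (PA.N + 1) * PA.d + (KCmax + 1) + cU ≤ cS)
    (hE : Rlev + (PA.N * (tanOff PA.ℓs PA.M + 1) + PA.N * PA.d + KCmax) ≤ E)
    (hreach : r + (PA.N * (tanOff PA.ℓs PA.M + 1) + PA.N * PA.d + KCmax) ≤ PA.r₀)
    (hrim : Λ.rM a' (x + stepVec du) - L' + PA.r₀ ≤ Λ.rE a' x du)
    -- the short region and the zone datum at the kit centres (inside `Rg`, connected, containing the centre and the fat-prism box `cylBallFin c kz Rk`)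
    (Rg : V → Finset V) (hRg : ∀ c, ∀ u ∈ Rg c, u ∈ graphBall G c Rs) (hRgcard : ∀ c, (Rg c).card ≤ cU) (hcU1 : 1 ≤ cU)
    (Λc : V → ℕ → Finset V) (kz : ℕ) (hΛRg : ∀ c, Λc c kz ⊆ Rg c) (hzconn : ∀ c, ∀ s ∈ Λc c kz, PathIn G (↑(Λc c kz) : Set V) c s)
    (hcz : ∀ c, c ∈ Λc c kz) {Rk : ℕ} (hkz : 1 ≤ kz) (hRk : cylRadMax G φ types kz (2 * KCmax) ≤ Rk)
    (hΛcyl : ∀ c, cylBallFin G φ c kz Rk ⊆ Λc c kz)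
    (kk : ℕ) {Wt : Sym2 V → unitInterval}
    (hN : kk * (Δ + 1) ^ (2 * rs) ≤ N) (hk : (1 - (q : ℝ) ^ (1 + Δ * cS + cS * cU)) ^ kk ≤ δ)
    -- THE ROUTE at every centre of the enlarged box near the window centre, at accuracy `δ³`
    (hroute : ∀ c, pr.frame φ w₀ du.1 b c ∈ Finset.Icc (loN P x du j pc aw - ((E : ℕ) : Site 2)) (hiN P x du j pc aw + ((E : ℕ) : Site 2)) →
      c ∈ graphBall G w₀ (Λ.rE a' x du - r) →
      ∃ Qt Ft : Finset V, Ft ⊆ (faceStepWNb G pr φ P w₀ Λ b₀ b a' x du j pc aw Rlev N M L' Sfin).T ∧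
        Qt ⊆ stepRg G (pr.frame φ w₀ du.1 b) (faceStepWNb G pr φ P w₀ Λ b₀ b a' x du j pc aw Rlev N M L' Sfin) ∧
        1 - δ ^ 3 ≤ (prodBernoulli Wt).real (linkIn (↑Qt : Set V) (Λc c kz) Ft)) :
    let Q := faceStepWNb G pr φ P w₀ Λ b₀ b a' x du j pc aw Rlev N M L' Sfin
    ∃ (σ : KNLevels.SData V) (Sz : Finset V),
      KNLevels.SHyp (winLData G (pr.frame φ w₀ du.1 b) Q.root Q.Rπ Q.lo Q.hi Q.root Q.Sfin) j' σ ∧ σ.N ≤ Q.N ∧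
      (1 - (q : ℝ) ^ σ.sB) ^ σ.k ≤ δ ∧ Sz ⊆ stepRg G (pr.frame φ w₀ du.1 b) Q ∧ (∀ x' ∈ σ.K, σ.face x' ⊆ Sz) ∧
      KNLevels.RelayClause (winLData G (pr.frame φ w₀ du.1 b) Q.root Q.Rπ Q.lo Q.hi Q.root Q.Sfin) Wt j' σ Sz Q.T
        (stepRg G (pr.frame φ w₀ du.1 b) Q) δ := by
  intro Q
  -- the wide level box
  have hw := loN_hiN_hwide P x du j pc aw hj'M
  have hwide : ∀ i, (loN P x du j pc aw - (j' : Site 2)) i + 2 * tanOff PA.ℓs PA.M ≤ (hiN P x du j pc aw + (j' : Site 2)) i := fun i => by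
    have := hw i; linarith
  have hMd' : ((PA.d + 2 : ℕ) : ℤ) ≤ 2 * M + 2 := by exact_mod_cast hMd
  have hMD' : ((shellD PA + 1 + PA.d + KCmax + Rs : ℕ) : ℤ) ≤ 2 * M + 2 := by exact_mod_cast hMD
  have hdw : ∀ i, (loN P x du j pc aw - (j' : Site 2)) i + (PA.d + 2 : ℕ) ≤ (hiN P x du j pc aw + (j' : Site 2)) i := fun i => by
    have := hw i; linarith
  have hDw : ∀ i, (loN P x du j pc aw - (j' : Site 2)) i + ((shellD PA + 1 + PA.d + KCmax + Rs : ℕ) : ℤ) ≤ (hiN P x du j pc aw + (j' : Site 2)) i :=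
    fun i => by have := hw i; linarith
  -- the level inside the region; the far part inside the rim
  have hXD : winLevel G (pr.frame φ w₀ du.1 b) w₀ (Λ.rE a' x du) (loN P x du j pc aw) (hiN P x du j pc aw) j' ⊆
      stepRg G (pr.frame φ w₀ du.1 b) Q :=
    winLevel_subset_stepRg_faceStepWNb G φ P w₀ Λ b₀ a' N M L' Sfin hyF hpc hjK hRlev hRlev' hc₀ hc₁ hD hnz hroomF hkF (by omega)
  have hfarT : ∀ v ∈ winLevel G (pr.frame φ w₀ du.1 b) w₀ (Λ.rE a' x du) (loN P x du j pc aw) (hiN P x du j pc aw) j',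
      v ∉ graphBall G w₀ (Λ.rE a' x du - PA.r₀) → v ∈ Q.T := fun v hv hfar =>
    far_mem_faceStepWNb_T G φ pr P w₀ Λ b₀ b a' x du j pc aw Rlev N M L' Sfin hrim (hXD hv) hfar
  have hE' : j' + (PA.N * (tanOff PA.ℓs PA.M + 1) + PA.N * PA.d + KCmax) ≤ E := le_trans (by omega) hE
  exact FinePrm.hkits_face_of_routeF hlipφ hstep hfr hκ hΔ hδ pr w₀ du.1 b hD hL0 hL1 (pr.cOf_pos hc₀ hc₁ du.1) hA0 hb hnz hnC hU3
    PA hPN hA hdD hDρ hKCmax hwide hdw hDw hT' hr₀ hR hrs hcS hE' hreach Rg hRg hRgcard hcU1 Λc kz hΛRg hzconn hcz hkz hRk hΛcyl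
    kk w₀ Sfin hXD hfarT hN hk hroute

end Skelφ

end Summit.CriticalPhenomena.PercolationContinuityZ3.Theorems.Transplant

end
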